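import Literature.MathematicalPhysics.QuantumFieldTheory.Balaban1983to89.B9Eq367TowerQGGQInvLadder
import Literature.MathematicalPhysics.QuantumFieldTheory.Balaban1983to89.B9Eq349TowerSiteRowSeam
import Literature.MathematicalPhysics.QuantumFieldTheory.Balaban1983to89.B9Eq326WoodburyLettersTower

/-!
# `Balaban1983to89.B9Eq367TowerQGGQInvLadderClosed` — T. Bałaban, *Propagators for lattice gauge theories in a background field*, Commun. Math. Phys. **99** (1985) 389–434
# [Balaban1985BackgroundPropagators] (3.65)–(3.67) p. 403 («The inverse satisfies Theorem 3.2»), Thm 3.2 (3.48) p. 398, Thm 3.11 p. 416, (3.25) p. 394, with [Balaban1984PropagatorsII]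
# (2.51)–(2.55) p. 232, (2.66) p. 234: **THE TWO-BACKGROUND LADDER FOR THE NE9 CHAIN's CONSTRUCTED `k`-LEVEL INVERSE THIRD OPERATOR `c_k(U) = greenK (Q̃′_kG′_k(U)²Q̃′_k(U)†)`, WITH THE
# ROWS CLOSED** — the rows at `U` and at `1` are the OWNER lineage's CLOSED letter `B9Eq326WoodburyLettersTower.exists_local_letter_QGGQInvk_closed` (`∃ α₁ C ρ` before the lattice,
# blocks = sites), read over `towerGeom` by `B9Eq349TowerSiteRowSeam`, and fed with the word ladder to `B9Eq367TowerQGGQInvLadder`: on print's small-field class (the MODEL letters' windows: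
# corner Wilson loops `hreg`, plaquettes, bond and level windows, unitary `U`), **`conj b (readA φ c_k(U)) − conj b (readA φ c_k(1)) ≺ K·α·e^{−δ d}`** with `α_X, K, δ` BEFORE `n, η, m, U`

statement-level skeleton of published theorems with citation tags; proofs where landed; nothing here is a claim about the Yang–Mills mass gap

CITATION HEADER (lean-in-tree rule).  Audit cell `pub-balaban`, sub-cell `t4`, BINDER row NE9; NE9 crux-team LEAF PROVER 01 (`b2b-balaban-t4-ne9-formalise-leaf-01`,
gen 99; bears_on: R4/N22).  Vocabulary BY NAME: the OWNER's `B9Eq326WoodburyLettersTower.exists_local_letter_QGGQInvk_closed`, `B9Eq325ProjFormulaTower.QGGQk_pos`,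
`B9Eq310HessianHermitian.adTransportW_adjoint`, `B11Eq103H1Complex.greenK` ∕ `apply_greenK`; this lineage's `B9Eq349TowerSiteRowSeam.hasMajorant_conj_readA_of_siteRow_tdist`,
`B9Eq367TowerQGGQInvLadder.exists_hasMajorant_QGGQInv_sub_flat`, `B9Eq342TowerFlatBaseMajorants` (the vacuum is in the class), `B9Eq315QTowerFlat` (flat level letters), r06's
`B9Eq352DivFormLetters.conj`, `B9Eq324PenaltyKernelForm.readA`, pv08's `B6RandomWalk.HasMajorant`.  Sources read through those files' verbatim quotations: [Balaban1985BackgroundPropagators]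
pp. 394, 398, 403, 416; [Balaban1984PropagatorsII] pp. 232, 234.  [folklore] COMPOSITION BY NAME; NOTHING of print's proofs is reproduced beyond what the named files prove.

WHAT IS PROVED (sorry-free; proof lane — no `def`).
* **`exists_hasMajorant_greenK_QGGQk_sub_flat`** — `∃ α_X > 0, K ≥ 0, δ > 0` BEFORE the lattice: on the class, for the chain's constructed inverses at `U` and at `1` (ANY positivity witnesses of
  `Δ′_{a′,k}`, ANY point family `r`, ANY `M, R_r, H`): `conj b (readA φ c_k(U)) − conj b (readA φ c_k(1)) ≺ K·α·e^{−δ·d(a,a′)}` over `towerGeom` (blocks = sites).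
HONEST SCOPE.  Junction only; the rows' constants are the OWNER's closed MODEL letters («NE9 ⇐ the named binders»; O-NE9-1, #5 UNRULED); constants crude (NOT print's); NOT `R_k`, NOT
the bond `G_k`; NE9 NOT PRINTED ∕ NOT PROVED; spine PROVED 0∕9; rung (B)+1 finite T⁴ — NOT infinite volume, NOT mass gap, NOT BetaPertH, NOT Clay.  HONEST DEPENDENCY: continuum YM on T⁴ ⇐
BetaPertH ∧ nine spine estimates (0/9 proved); BetaPertH ⇐ (D1) ∧ (D4) ∧ CAP+tail; G-an2-4 gates asym, D1 and NE2/3/4.  NEW file; nothing modified.  Net new unproved facts: 0.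
-/

noncomputable section

open scoped BigOperators InnerProductSpace

namespace Literature.MathematicalPhysics.QuantumFieldTheory.Balaban1983to89.B9Eq367TowerQGGQInvLadderClosed

open B4Sect5Torus (TSite tdist)
open B7Prop1Explicit (U1 Wcx boxVec)
open B9SectCLatticeCarrier (Bond shift)
open B9Eq311L2Pairing (WL2)
open B11Eq103H1Complex (SiteL2K greenK apply_greenK)
open B9Eq310HessianOperator (adTransportW)
open B9Eq310HessianHermitian (adTransportW_adjoint)
open B9Eq310DeltaPrime (plaqHolU plaqHolU_one)
open B9Eq315QTower (towerP UlevOf)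
open B9Eq315QTorus (perCfg cornerSite)
open B9Eq315QTowerFlat (perCfg_UlevOf_one_mem_U1 norm_Wcx_UlevOf_one_sub_one_le)
open B9Eq326OperatorTower (QprimeTowerW)
open B9Eq324DeltaPrimeATower (laplacePrimeAk GpOfUk)
open B9Eq325ProjFormulaTower (QGGQk_pos)
open B6RandomWalk (HasMajorant)
open B9Thm34Ext (toB6)
open B9Eq352DivFormLetters (conj)
open B9Eq324PenaltyKernelForm (readA)
open B9Eq341TowerBlockGeometry (towerGeom)
open B9Eq342TowerFlatBaseMajorants (UlevOf_one_norm_sub_one_le UlevOf_one_mem_U1 star_one_eq_inv_one)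
open B9Eq326WoodburyLettersTower (exists_local_letter_QGGQInvk_closed)
open B9Eq349TowerSiteRowSeam (hasMajorant_conj_readA_of_siteRow_tdist)
open B9Eq367TowerQGGQInvLadder (exists_hasMajorant_QGGQInv_sub_flat)

variable {d : ℕ} (L : ℕ) [NeZero L] {𝔸 : Type*} [NormedRing 𝔸] [NormedAlgebra ℂ 𝔸] [CompleteSpace 𝔸] [NormOneClass 𝔸] [StarRing 𝔸] [NormedStarGroup 𝔸] [StarModule ℂ 𝔸]
  [FiniteDimensional ℂ 𝔸]
  {W : Type*} [NormedAddCommGroup W] [InnerProductSpace ℂ W] [FiniteDimensional ℂ W] (φ : W ≃ₗ[ℂ] 𝔸) {a a' Mφ Mφ' : ℝ}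
  (hMφ : 0 ≤ Mφ) (hMφ' : 0 ≤ Mφ') (hφn : ∀ w, ‖φ w‖ ≤ Mφ * ‖w‖) (hφn' : ∀ X, ‖φ.symm X‖ ≤ Mφ' * ‖X‖) (ha : 0 < a) (ha' : 0 < a')
  {r : ℝ} (hr0 : 0 ≤ r) (hr1 : r < 1)
  (τ : 𝔸 →ₗ[ℂ] ℂ) {Cτ : ℝ} (hτ : ∀ X, ‖τ X‖ ≤ Cτ * ‖X‖) (hCτ : 0 ≤ Cτ) {ρw : ℝ} (hρw : 0 ≤ ρw)
  (hτ₁ : ∀ X : 𝔸, τ (star X) = starRingEnd ℂ (τ X)) (hτ₂ : ∀ X Y : 𝔸, τ (X * Y) = τ (Y * X)) (hφτ : ∀ X Y : 𝔸, ⟪φ.symm X, φ.symm Y⟫_ℂ = τ (star X * Y))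
  {Mτ : ℝ} (hMτ : 0 ≤ Mτ)
  {ι : Type} [Fintype ι] [DecidableEq ι] (b : Module.Basis ι ℝ 𝔸) {M₂ : ℝ} (hM₂ : 0 ≤ M₂) (hrepr : ∀ (v : 𝔸) (i : ι), |b.repr v i| ≤ M₂ * ‖v‖)

include hMφ hMφ' hφn hφn' ha ha' hr0 hr1 hτ hCτ hρw hτ₁ hτ₂ hφτ hMτ hM₂ hrepr in
/-- **THE TWO-BACKGROUND LADDER FOR THE CONSTRUCTED `c_k`, ROWS CLOSED** (see the module docstring).
[cite: Balaban1985BackgroundPropagators, (3.65)–(3.67) p.403, Thm 3.2 (3.48) p.398, Thm 3.11 p.416, (3.25) p.394; Balaban1984PropagatorsII, (2.51)–(2.55) p.232, (2.66) p.234] -/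
theorem exists_hasMajorant_greenK_QGGQk_sub_flat (hd : 1 ≤ d) (hL : 1 ≤ L) (hL3 : 3 ≤ L) :
    ∃ αX K δ : ℝ, 0 < αX ∧ 0 ≤ K ∧ 0 < δ ∧
      ∀ (n : ℕ) (η : ℝ), η * (L : ℝ) ^ (n + 1) = 1 →
      ∀ (c₀ c₁ : ℝ) [Fact (0 < c₀)] [Fact (0 < c₁)], c₀ * ((L : ℝ) ^ (n + 1)) ^ d = c₁ → |η| ^ d / c₀ ≤ ρw →
      ∀ (m : Fin d → ℕ) [∀ i, NeZero (m i)], (∀ i, 1 ≤ m i) → ∀ (U : Bond d (towerP L m (n + 1)) → 𝔸ˣ) (α : ℝ), 0 ≤ α → α ≤ αX →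
        (∀ bd, U bd ∈ U1 𝔸) → (∀ bd, ‖(U bd : 𝔸) - 1‖ ≤ α * η) →
        (∀ (x : TSite d (towerP L m (n + 1))) (μ ν : Fin d), ‖(U (shift ν x, μ) : 𝔸) - (U (x, μ) : 𝔸)‖ ≤ α * η ^ 2) →
        (∀ p : B9SectCLatticeCarrier.Plaq d (towerP L m (n + 1)), ‖(plaqHolU U p : 𝔸) - 1‖ ≤ α * η ^ 2) →
      ∀ (hUst : ∀ bd, star (U bd : 𝔸) = (((U bd)⁻¹ : 𝔸ˣ) : 𝔸))
        (αU : ℕ → ℝ), (∀ j, αU j ≤ 1 / 64) →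
        (∀ (j : ℕ) (x : B7Prop1Explicit.Site d) (k : Fin d), perCfg (towerP L m (j + 1)) (UlevOf L m (n + 1) U j) x k ∈ U1 𝔸) →
        (∀ (j : ℕ) (y : TSite d (towerP L m j)) (k : Fin d) (ρ' : Fin d → Fin L),
          ‖((Wcx L (perCfg (towerP L m (j + 1)) (UlevOf L m (n + 1) U j)) (cornerSite L y) k (boxVec L ρ') : 𝔸ˣ) : 𝔸) - 1‖ ≤ αU j) →
      ∀ (εU : ℕ → ℝ), (∀ j, 0 ≤ εU j) → (∀ j, εU j ≤ 1) → (∀ j < n + 1, εU j ≤ α * r ^ j) →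
        (∀ (j : ℕ) (bd : Bond d (towerP L m (j + 1))), ‖(UlevOf L m (n + 1) U j bd : 𝔸) - 1‖ ≤ εU j) →
        (∀ (j : ℕ) (bd : Bond d (towerP L m (j + 1))), UlevOf L m (n + 1) U j bd ∈ U1 𝔸) →
        (∀ (j : ℕ) (bd : Bond d (towerP L m (j + 1))) (w : W), ‖adTransportW φ (UlevOf L m (n + 1) U j) bd w‖ ≤ ‖w‖) →
      ∀ (hposU : ∀ x : SiteL2K ℂ d (towerP L m (n + 1)) c₀ W, x ≠ 0 → 0 < RCLike.re ⟪x, laplacePrimeAk L m n φ η U a' (c₁ := c₁) x⟫_ℂ)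
        (hpos₁ : ∀ x : SiteL2K ℂ d (towerP L m (n + 1)) c₀ W, x ≠ 0 →
          0 < RCLike.re ⟪x, laplacePrimeAk L m n φ η (fun _ : Bond d (towerP L m (n + 1)) => (1 : 𝔸ˣ)) a' (c₁ := c₁) x⟫_ℂ)
        (rr : TSite d m → SiteL2K ℂ d m c₁ W →L[ℂ] SiteL2K ℂ d m c₁ W),
        (∀ (y : TSite d m) (g : SiteL2K ℂ d m c₁ W) (y' : TSite d m),
          WL2.equiv ℂ (fun _ : TSite d m => c₁) W (rr y g) y' = if y' = y then WL2.equiv ℂ (fun _ : TSite d m => c₁) W g y' else 0) →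
      ∀ (M Rr : ℝ) (H : Prop),
      HasMajorant (g := toB6 (towerGeom L m n η M) Rr H) (fun q : TSite d m × ι => q.1)
        (conj b (readA φ (greenK _ (QGGQk_pos L m n φ c₀ η U c₁ a' (adTransportW_adjoint φ τ hτ₂ hUst hφτ) hposU))) -
          conj b (readA φ (greenK _ (QGGQk_pos L m n φ c₀ η (fun _ : Bond d (towerP L m (n + 1)) => (1 : 𝔸ˣ)) c₁ a' (adTransportW_adjoint φ τ hτ₂ (star_one_eq_inv_one L m n) hφτ) hpos₁))))
        (fun a a' => K * α * Real.exp (-(δ * (towerGeom L m n η M).dist a a'))) := by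
  obtain ⟨α₁, C, ρ, hα₁, hC, hρ, ROW⟩ :=
    exists_local_letter_QGGQInvk_closed hd L hL hL3 φ hMφ hMφ' hφn hφn' ha ha' hr0 hr1 τ hτ hCτ hρw hτ₁ hτ₂ hφτ hMτ
  have hSb : 0 ≤ ∑ i, ‖b i‖ := Finset.sum_nonneg fun i _ => norm_nonneg _
  have hKc : 0 ≤ M₂ * (∑ i, ‖b i‖) * (Mφ * Mφ') * C := by positivity
  have hδc : 0 < ρ / d := div_pos hρ (by exact_mod_cast hd)
  obtain ⟨αX, K, δ, hαX, hK, hδ, HX⟩ :=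
    exists_hasMajorant_QGGQInv_sub_flat L φ hMφ hMφ' hφn hφn' ha' hr0 hr1 τ hτ₂ hφτ b hM₂ hrepr hd hL3 hKc hδc
  refine ⟨min α₁ αX, K, δ, lt_min hα₁ hαX, hK, hδ, ?_⟩
  intro n η hη c₀ c₁ _ _ hc hρη m _ hm U α hα0 hαle hU1 hUs hUw hpl hUst αU hα1 hU1p hreg εU hε0 hε1 hεr hlev hlev1 hRlev hposU hpos₁ rr hrr M Rr H
  have hα₁' : α ≤ α₁ := hαle.trans (min_le_left _ _)
  have hαX' : α ≤ αX := hαle.trans (min_le_right _ _)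
  have hη0 : 0 ≤ η := by
    have hLp : (0 : ℝ) < (L : ℝ) ^ (n + 1) := by
      have : (0 : ℝ) < (L : ℝ) := by exact_mod_cast (Nat.pos_of_ne_zero (NeZero.ne L))
      positivity
    nlinarith
  -- the rows at `U` and at `1` (the owner's closed letter), read over `towerGeom`
  have hrowU := hasMajorant_conj_readA_of_siteRow_tdist L m n η M Rr H φ hMφ hMφ' hφn hφn' b hM₂ hrepr hd
    (greenK _ (QGGQk_pos L m n φ c₀ η U c₁ a' (adTransportW_adjoint φ τ hτ₂ hUst hφτ) hposU)) hC hρ.le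
    (fun v g F hgv hgF x => ROW n η hη c₀ c₁ hc hρη m hm U αU hα1 hU1p hreg εU hε0 hlev hlev1 α hα0 hα₁' hUst hU1 hUs hpl hεr hposU rr hrr v g F hgv hgF x)
  have hrow1 := hasMajorant_conj_readA_of_siteRow_tdist L m n η M Rr H φ hMφ hMφ' hφn hφn' b hM₂ hrepr hd
    (greenK _ (QGGQk_pos L m n φ c₀ η (fun _ : Bond d (towerP L m (n + 1)) => (1 : 𝔸ˣ)) c₁ a' (adTransportW_adjoint φ τ hτ₂ (star_one_eq_inv_one L m n) hφτ) hpos₁)) hC hρ.le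
    (fun v g F hgv hgF x => ROW n η hη c₀ c₁ hc hρη m hm (fun _ : Bond d (towerP L m (n + 1)) => (1 : 𝔸ˣ)) (fun _ => 0) (fun _ => by norm_num)
      (perCfg_UlevOf_one_mem_U1 L m (n + 1)) (norm_Wcx_UlevOf_one_sub_one_le L m (n + 1) (fun _ => 0) (fun _ => le_rfl))
      (fun _ => 0) (fun _ => le_rfl) (UlevOf_one_norm_sub_one_le L m n) (UlevOf_one_mem_U1 L m n) α hα0 hα₁' (star_one_eq_inv_one L m n)
      (fun _ => one_mem _) (fun _ => by simp only [Units.val_one, sub_self, norm_zero]; positivity)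
      (fun _ => by simp only [plaqHolU_one, Units.val_one, sub_self, norm_zero]; positivity) (fun _ _ => by positivity) hpos₁ rr hrr v g F hgv hgF x)
  -- the constructed inverses are right inverses of the chain's words
  have hXcU : (((WL2.linearEquiv ℂ ℂ (fun _ : TSite d m => c₁)).symm.toLinearMap ∘ₗ QprimeTowerW L m n φ U (c₀ := c₀)) ∘ₗ
        (GpOfUk L m n φ η U a' (c₁ := c₁) hposU ∘ₗ GpOfUk L m n φ η U a' (c₁ := c₁) hposU) ∘ₗ
          LinearMap.adjoint ((WL2.linearEquiv ℂ ℂ (fun _ : TSite d m => c₁)).symm.toLinearMap ∘ₗ QprimeTowerW L m n φ U (c₀ := c₀))) ∘ₗ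
      greenK _ (QGGQk_pos L m n φ c₀ η U c₁ a' (adTransportW_adjoint φ τ hτ₂ hUst hφτ) hposU) = LinearMap.id :=
    LinearMap.ext fun v => by
      have key : (((WL2.linearEquiv ℂ ℂ (fun _ : TSite d m => c₁)).symm.toLinearMap ∘ₗ QprimeTowerW L m n φ U (c₀ := c₀)) ∘ₗ
        GpOfUk L m n φ η U a' (c₁ := c₁) hposU ∘ₗ GpOfUk L m n φ η U a' (c₁ := c₁) hposU ∘ₗ
          LinearMap.adjoint ((WL2.linearEquiv ℂ ℂ (fun _ : TSite d m => c₁)).symm.toLinearMap ∘ₗ QprimeTowerW L m n φ U (c₀ := c₀)))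
          (greenK _ (QGGQk_pos L m n φ c₀ η U c₁ a' (adTransportW_adjoint φ τ hτ₂ hUst hφτ) hposU) v) = v := apply_greenK _ v
      simpa only [LinearMap.comp_apply, LinearMap.id_apply] using key
  have hXc1 : (((WL2.linearEquiv ℂ ℂ (fun _ : TSite d m => c₁)).symm.toLinearMap ∘ₗ QprimeTowerW L m n φ (fun _ : Bond d (towerP L m (n + 1)) => (1 : 𝔸ˣ)) (c₀ := c₀)) ∘ₗ
        (GpOfUk L m n φ η (fun _ : Bond d (towerP L m (n + 1)) => (1 : 𝔸ˣ)) a' (c₁ := c₁) hpos₁ ∘ₗ GpOfUk L m n φ η (fun _ : Bond d (towerP L m (n + 1)) => (1 : 𝔸ˣ)) a' (c₁ := c₁) hpos₁) ∘ₗ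
          LinearMap.adjoint ((WL2.linearEquiv ℂ ℂ (fun _ : TSite d m => c₁)).symm.toLinearMap ∘ₗ QprimeTowerW L m n φ (fun _ : Bond d (towerP L m (n + 1)) => (1 : 𝔸ˣ)) (c₀ := c₀))) ∘ₗ
      greenK _ (QGGQk_pos L m n φ c₀ η (fun _ : Bond d (towerP L m (n + 1)) => (1 : 𝔸ˣ)) c₁ a' (adTransportW_adjoint φ τ hτ₂ (star_one_eq_inv_one L m n) hφτ) hpos₁) = LinearMap.id :=
    LinearMap.ext fun v => by
      have key : (((WL2.linearEquiv ℂ ℂ (fun _ : TSite d m => c₁)).symm.toLinearMap ∘ₗ QprimeTowerW L m n φ (fun _ : Bond d (towerP L m (n + 1)) => (1 : 𝔸ˣ)) (c₀ := c₀)) ∘ₗ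
        GpOfUk L m n φ η (fun _ : Bond d (towerP L m (n + 1)) => (1 : 𝔸ˣ)) a' (c₁ := c₁) hpos₁ ∘ₗ GpOfUk L m n φ η (fun _ : Bond d (towerP L m (n + 1)) => (1 : 𝔸ˣ)) a' (c₁ := c₁) hpos₁ ∘ₗ
          LinearMap.adjoint ((WL2.linearEquiv ℂ ℂ (fun _ : TSite d m => c₁)).symm.toLinearMap ∘ₗ QprimeTowerW L m n φ (fun _ : Bond d (towerP L m (n + 1)) => (1 : 𝔸ˣ)) (c₀ := c₀)))
          (greenK _ (QGGQk_pos L m n φ c₀ η (fun _ : Bond d (towerP L m (n + 1)) => (1 : 𝔸ˣ)) c₁ a' (adTransportW_adjoint φ τ hτ₂ (star_one_eq_inv_one L m n) hφτ) hpos₁) v) = v := apply_greenK _ v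
      simpa only [LinearMap.comp_apply, LinearMap.id_apply] using key
  exact HX n η hη c₀ c₁ hc m U α hα0 hαX' hU1 hUs hUw εU hε0 hε1 hεr hlev hlev1 hRlev hposU hpos₁ M Rr H _ _ hXcU hXc1 hrowU hrow1

end Literature.MathematicalPhysics.QuantumFieldTheory.Balaban1983to89.B9Eq367TowerQGGQInvLadderClosed

end
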